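import Summits.KontsevichZagierPeriods.KontsevichZagierPeriods.Theses.HurwitzMicroSectors
import Literature.NumberTheory.Transcendental.SemialgebraicMapsProofs
import Summits.KontsevichZagierPeriods.KontsevichZagierPeriods.Theorems.HurwitzMicroSectorsNormalFormPrinciplePiBoxTransfer

/-!
# `NormalFormPrincipleSplitGlue` (stmt-KontsevichZagierPeriods-15289) — the strategist's split of
# the crux `NormalFormPrinciple` (stmt-KontsevichZagierPeriods-3869) along `[π]`, glued

Pure proof file for the support item
`NormalFormPrincipleSplitGlue : AyoubPiLocalKernel → AyoubPiCancellation → NormalFormPrinciple`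
of route KontsevichZagierPeriods/HurwitzMicroSectors. The two hypotheses are, verbatim, the bodies
of items stmt-KontsevichZagierPeriods-0541 (`π`-local kernel: every formal combination of value `0`
becomes a relation after enough multiplications by a pinned product `P n r = [π] ⋆ r`) and
stmt-KontsevichZagierPeriods-0540 (`π`-cancellation: `P`-multiplication reflects relations).

Proof (self-contained; it is the script of route AyoubSpecialisation's deciding theorem `closes`,
re-run here so that this route does not import that route file):

1. `exists_pinnedProduct` — the pinned product EXISTS: for every `r : IntegralRep n` a
   representation on `{z | z₀² + z₁² ≤ 1 ∧ (z₂, …, z_{n+1}) ∈ r.domain}` with integrand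
   `z ↦ r.integrand (z₂, …)` (semialgebraicity of domain and integrand by coordinate preimages,
   no Tarski–Seidenberg; integrability by two Tonelli steps `[-1,1] × ·` and shrinking to the
   disc). Without it the two `∀ P`-hypotheses would be consumed vacuously.
2. `normalFormPrincipleSplitGlue_proof` — the item by name: unfold, introduce the two hypotheses,
   `π`-peeling (for `c ∈ ker eval` the local-kernel hypothesis gives `(P⋆)^[N] c ∈ relations` and
   cancellation removes one factor at a time, induction on `N`), so `ker eval ⊆ relations`; equal
   values of rational representations then give `[r] − [r'] ∈ relations`, i.e. the summit
   statement, and `PiBox.normalFormPrinciple_of_statement` (`𝒩 :=` the rational representations,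
   Theorems/HurwitzMicroSectorsNormalFormPrinciplePiBoxTransfer) turns it into the crux.

Only the direction the item states is proved here; exactness of the split
(`NormalFormPrinciple ↔ KZ.PiLocalKernel ∧ KZ.PiCancellation`, closed-term forms) is the residual
certificate `normalFormPrinciple_iff_piLocalKernel_and_piCancellation` of
Theorems/HurwitzMicroSectorsNormalFormPrinciplePiBoxResidual and is deliberately not imported.
Sources: M. Kontsevich, D. Zagier, *Periods* (2001), §1.2 Conjecture 1 and §4.1
(`P̂ = P[(2πi)⁻¹]`); J. Ayoub, *Periods and the conjectures of Grothendieck and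
Kontsevich–Zagier*, EMS Newsl. 91 (2014), Def. 6 / Conj. 7; A. Huber, G. Wüstholz,
*Transcendence and linear relations of 1-periods* (2022), App. A (the effective-versus-localised
seam).
-/

noncomputable section

open scoped BigOperators Topology Classical MeasureTheory
open Filter Set Function TopologicalSpace MeasureTheory
open Literature Periods

namespace Summit.KontsevichZagierPeriods.HurwitzMicroSectors.NormalFormPrincipleSplitGlue

open Summit.KontsevichZagierPeriods.KontsevichZagierPeriods.Theses

/-- **The pinned product `[π] ⋆ r` exists.** For every `r : IntegralRep n` there is a
representation `P n r : IntegralRep (n + 2)` with domain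
`{z | z 0 ^ 2 + z 1 ^ 2 ≤ 1 ∧ (z₂, …, z_{n+1}) ∈ r.domain}` (unit disc in the two leading
coordinates) and integrand `z ↦ r.integrand (z₂, …, z_{n+1})`. The domain is `ℚ`-semialgebraic as
a polynomial inequality meets a coordinate preimage, the integrand as a coordinate preimage of the
graph of `r.integrand` cut down to the cylinder, and absolute convergence is two Tonelli steps
(`[-1, 1] × ·`, splitting off coordinate `0` with `MeasurableEquiv.piFinSuccAbove`) followed by
shrinking `[-1,1]²` to the disc. Adapted verbatim from step (1) of route AyoubSpecialisation's
deciding theorem `closes` (its support item `PiProductRep`, stmt-KontsevichZagierPeriods-10941).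
[cite: KontsevichZagier2001, §4.1] -/
theorem exists_pinnedProduct :
    ∃ (P : ∀ n : ℕ, Literature.NumberTheory.Transcendental.KZ.IntegralRep n →
        Literature.NumberTheory.Transcendental.KZ.IntegralRep (n + 2)),
      ∀ (n : ℕ) (r : Literature.NumberTheory.Transcendental.KZ.IntegralRep n),
        (P n r).domain = {z : Fin (n + 2) → ℝ | z 0 ^ 2 + z 1 ^ 2 ≤ 1 ∧
            (fun i : Fin n => z i.succ.succ) ∈ r.domain} ∧
        (P n r).integrand = fun z => r.integrand (fun i : Fin n => z i.succ.succ) := by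
  -- Tonelli step: integrability survives prefixing one bounded coordinate.
  have step : ∀ (m : ℕ) (S : Set (Fin m → ℝ)) (g : (Fin m → ℝ) → ℝ), IntegrableOn g S →
      IntegrableOn (fun z : Fin (m + 1) → ℝ => g (fun i => z i.succ))
        {z : Fin (m + 1) → ℝ | z 0 ∈ Icc (-1 : ℝ) 1 ∧ (fun i => z i.succ) ∈ S} := by
    intro m S g hg
    set e := MeasurableEquiv.piFinSuccAbove (fun _ : Fin (m + 1) => ℝ) 0 with he_def
    have he : MeasurePreserving e volume volume :=
      volume_preserving_piFinSuccAbove (fun _ : Fin (m + 1) => ℝ) 0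
    have happly : ∀ z : Fin (m + 1) → ℝ, e z = (z 0, fun i => z i.succ) := fun z => rfl
    have hc : IntegrableOn (fun _ : ℝ => (1 : ℝ)) (Icc (-1 : ℝ) 1) :=
      integrableOn_const measure_Icc_lt_top.ne
    have hprod : IntegrableOn (fun p : ℝ × (Fin m → ℝ) => (fun _ : ℝ => (1 : ℝ)) p.1 * g p.2)
        (Icc (-1 : ℝ) 1 ×ˢ S) := by
      rw [IntegrableOn, Measure.volume_eq_prod, ← Measure.prod_restrict]
      exact hc.mul_prod hg
    have h2 := (he.integrableOn_comp_preimage e.measurableEmbedding).mpr hprod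
    have hfun : ((fun p : ℝ × (Fin m → ℝ) => (fun _ : ℝ => (1 : ℝ)) p.1 * g p.2) ∘ e) =
        fun z => g (fun i => z i.succ) := by
      funext z
      simp [Function.comp, happly]
    have hset : e ⁻¹' (Icc (-1 : ℝ) 1 ×ˢ S) =
        {z : Fin (m + 1) → ℝ | z 0 ∈ Icc (-1 : ℝ) 1 ∧ (fun i => z i.succ) ∈ S} := by
      ext z
      simp [happly]
    rw [hfun, hset] at h2
    exact h2
  have key : ∀ (n : ℕ) (r : Literature.NumberTheory.Transcendental.KZ.IntegralRep n),
      ∃ q : Literature.NumberTheory.Transcendental.KZ.IntegralRep (n + 2),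
        q.domain = {z : Fin (n + 2) → ℝ | z 0 ^ 2 + z 1 ^ 2 ≤ 1 ∧
            (fun i : Fin n => z i.succ.succ) ∈ r.domain} ∧
        q.integrand = fun z => r.integrand (fun i : Fin n => z i.succ.succ) := by
    intro n r
    -- the domain `disc × σ` is ℚ-semialgebraic: a polynomial inequality meets a coordinate preimage
    have hD : Literature.ModelTheory.ExponentialFields.IsSemialgebraic ℚ
        {z : Fin (n + 2) → ℝ | z 0 ^ 2 + z 1 ^ 2 ≤ 1 ∧
            (fun i : Fin n => z i.succ.succ) ∈ r.domain} := by
      have h1 : Literature.ModelTheory.ExponentialFields.IsSemialgebraic ℚ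
          {z : Fin (n + 2) → ℝ | z 0 ^ 2 + z 1 ^ 2 ≤ 1} := by
        have := Literature.ModelTheory.ExponentialFields.isSemialgebraic_setOf_eval_le
          (k := ℚ) (R := ℝ) (MvPolynomial.X 0 ^ 2 + MvPolynomial.X 1 ^ 2 : MvPolynomial (Fin (n + 2)) ℚ) 1
        simpa using this
      have h2 := r.isSemialgebraic_domain.preimage_comp (fun i : Fin n => i.succ.succ)
      have hset : {z : Fin (n + 2) → ℝ | z 0 ^ 2 + z 1 ^ 2 ≤ 1 ∧
            (fun i : Fin n => z i.succ.succ) ∈ r.domain} =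
          {z : Fin (n + 2) → ℝ | z 0 ^ 2 + z 1 ^ 2 ≤ 1} ∩
            ((fun x : Fin (n + 2) → ℝ => x ∘ (fun i : Fin n => i.succ.succ)) ⁻¹' r.domain) := by
        ext z
        simp [Function.comp_def]
      rw [hset]
      exact h1.inter h2
    -- the integrand `z ↦ f (z₂, …, z_{n+1})` is ℚ-semialgebraic on it: coordinate preimage of the
    -- graph of `f`, cut down to the cylinder (no Tarski–Seidenberg)
    have hF : Literature.NumberTheory.Transcendental.IsSemialgebraicFunOn ℚ
        {z : Fin (n + 2) → ℝ | z 0 ^ 2 + z 1 ^ 2 ≤ 1 ∧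
            (fun i : Fin n => z i.succ.succ) ∈ r.domain}
        (fun z => r.integrand (fun i : Fin n => z i.succ.succ)) := by
      rw [Literature.NumberTheory.Transcendental.isSemialgebraicFunOn_iff]
      let ρ : Fin (n + 1) → Fin (n + 2 + 1) :=
        Fin.lastCases (Fin.last (n + 2)) fun i => Fin.castSucc i.succ.succ
      have hΓ := (Literature.NumberTheory.Transcendental.isSemialgebraicFunOn_iff.mp
        r.isSemialgebraicFunOn_integrand).preimage_comp ρ
      convert hD.setOf_init_mem.inter hΓ using 1
      have hinit : ∀ w : Fin (n + 2 + 1) → ℝ,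
          Fin.init (w ∘ ρ) = fun i : Fin n => Fin.init w i.succ.succ := by
        intro w; ext i; simp [Fin.init, ρ]
      have hlast : ∀ w : Fin (n + 2 + 1) → ℝ, (w ∘ ρ) (Fin.last n) = w (Fin.last (n + 2)) := by
        intro w; simp [ρ]
      ext w
      simp only [mem_setOf_eq, mem_inter_iff, mem_preimage, hinit, hlast]
      tauto
    -- absolute convergence: two Tonelli steps, then shrink the box `[-1,1]²` to the disc
    have hI : IntegrableOn (fun z : Fin (n + 2) → ℝ => r.integrand (fun i : Fin n => z i.succ.succ))
        {z : Fin (n + 2) → ℝ | z 0 ^ 2 + z 1 ^ 2 ≤ 1 ∧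
            (fun i : Fin n => z i.succ.succ) ∈ r.domain} := by
      have h := step (n + 1) _ _ (step n r.domain r.integrand r.integrableOn)
      refine h.mono_set ?_
      intro z hz
      simp only [mem_setOf_eq] at hz ⊢
      obtain ⟨hdisc, hdom⟩ := hz
      refine ⟨?_, ?_, ?_⟩
      · constructor <;> nlinarith [sq_nonneg (z 0 + 1), sq_nonneg (z 0 - 1), sq_nonneg (z 1)]
      · simp only [Fin.succ_zero_eq_one]
        constructor <;> nlinarith [sq_nonneg (z 1 + 1), sq_nonneg (z 1 - 1), sq_nonneg (z 0)]
      · simpa using hdom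
    exact ⟨⟨_, _, hD, hF, hI⟩, rfl, rfl⟩
  choose P hPin using key
  exact ⟨P, hPin⟩

/-- **The glue of the strategist's split** (item stmt-KontsevichZagierPeriods-15289, BY NAME):
`NormalFormPrincipleSplitGlue := AyoubPiLocalKernel → AyoubPiCancellation → NormalFormPrinciple`.
With a pinned product `P` from `exists_pinnedProduct` (so that neither `∀ P`-hypothesis is used
vacuously): for `c ∈ ker eval`, `AyoubPiLocalKernel` (item stmt-KontsevichZagierPeriods-0541) gives
`(lift (of ∘ P))^[N] c ∈ relations` and `AyoubPiCancellation` (item stmt-KontsevichZagierPeriods-0540)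
peels the `N` factors one at a time (induction on `N`, left-nested iterates,
`Function.iterate_succ_apply'`), so `ker eval ⊆ relations`; for rational `r`, `r'` with equal
values `eval ([r] − [r']) = 0`, whence the summit statement in KZ's literal form, and
`PiBox.normalFormPrinciple_of_statement` (`𝒩 :=` the rational representations) gives
`NormalFormPrinciple`. Same script as route AyoubSpecialisation's deciding theorem `closes`,
steps (2)–(3). [cite: Ayoub2014, Def. 6 and Conj. 7] -/
theorem normalFormPrincipleSplitGlue_proof : HurwitzMicroSectors.NormalFormPrincipleSplitGlue := by
  unfold HurwitzMicroSectors.NormalFormPrincipleSplitGlue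
  intro hloc hpc
  unfold HurwitzMicroSectors.AyoubPiLocalKernel at hloc
  unfold HurwitzMicroSectors.AyoubPiCancellation at hpc
  obtain ⟨P, hPin⟩ := exists_pinnedProduct
  -- π-peeling: `ker eval ⊆ relations`.
  have hS : ∀ c : Literature.NumberTheory.Transcendental.KZ.FormalRep,
      Literature.NumberTheory.Transcendental.KZ.eval c = 0 →
        c ∈ Literature.NumberTheory.Transcendental.KZ.relations := by
    intro c hc
    obtain ⟨N, hN⟩ := hloc P hPin c hc
    induction N with
    | zero => simpa using hN
    | succ N ih =>
      exact ih (hpc P hPin _ (by simpa only [Function.iterate_succ_apply'] using hN))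
  -- the KZ-literal statement (equal values ⇒ `[r] − [r'] ∈ ker eval = relations`), then the crux.
  refine Summit.KontsevichZagierPeriods.HurwitzMicroSectors.NormalFormPrinciple.PiBox.normalFormPrinciple_of_statement ?_
  intro n m r r' _ _ hv
  apply hS
  simp [Literature.NumberTheory.Transcendental.KZ.eval_of, hv]

end Summit.KontsevichZagierPeriods.HurwitzMicroSectors.NormalFormPrincipleSplitGlue

end
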